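import Summits.QuantumAdvantage.QuantumAdvantage.Theorems.CubicForrelationNearExactIsExactTwelveLevelFive932
import Summits.QuantumAdvantage.QuantumAdvantage.Theorems.CubicForrelationNearExactIsExactIsolationSmallN

/-!
# Crux `CubicForrelation.NearExactIsExact` (stmt-QuantumAdvantage-14043) — the Walsh spectrum of a QUADRATIC Boolean function on 12 bits
  from the 2-adic tower (no theory of quadratic forms), and the transform of a quadratic sign pattern on a half-space

Certificate seat `b2b-cforr-cert` (gen 18).  HONEST FRAMING: infrastructure lemmas (standard axioms) for the last open configuration at
`Φ = 932/1024` on 12 bits (a level-5 side, `…TwelveLevelFive932Dead`); finite-slice bookkeeping, NOT summit progress.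

* `qs_walshTower2`: the 2-adic Walsh tower for a QUADRATIC `D` (Ax on cubes with `d = 2`): if `W_D = 2^j·u` then the parity of `u` has
  degree `≤ d` whenever `j + 1 ≤ k + ⌈(n−k)/2⌉` for all `d < k ≤ n` (same proof as `stub_walshTower`).
* `qs_level` / `qs_spectrum` (12 bits): at the 2-adic level `j ∈ [6,12]` of `W_D` the parity of `u = W_D/2^j` has degree `≤ 2j − 12`, so its
  support has `≥ 2^{24−2j}` points (Reed–Muller), while Parseval gives `Σ u² = 2^{24−2j}`: hence `u ∈ {0, ±1}` with `{u ≠ 0} = {u odd}` —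
  i.e. `W_D ∈ {0, ±2^j}` for ONE `j ≥ 6`, and `W_D = ±64` everywhere when `j = 6`.
* `qs_halfspace`: `Σ_{x : (−1)^{γ·x} = t} F(x)(−1)^{x·y} = (F̂(y) + t·F̂(γ ⊕ y))/2`.
* `qs_hyperplane_sum`: for quadratic `D` and a half-space `P = {(−1)^{γ·x} = t}`, `Σ_{x ∈ P} (−1)^{D(x)+x·y} = 64·m(y)` with EITHER all
  `m(y)` even OR all `|m(y)| ≤ 2`.

References: J. Ax (1964) / R. J. McEliece (1972); MacWilliams–Sloane (1977) Ch. 13 §3, Ch. 15 §2; C. Carlet (2021) §4.1, §5.2.  Everything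
below is proved from Mathlib and the tree; axioms are the standard three.
-/

set_option linter.dupNamespace false -- D-0017: single-problem summit ⇒ `QuantumAdvantage.QuantumAdvantage` by design

noncomputable section

namespace Summit.QuantumAdvantage.QuantumAdvantage.Theorems.CubicForrelation.NearExactIsExact

open Finset
open Literature.Computability.QuantumComplexity
open Literature.Computability.QuantumComplexity.BuzetChailloux (bxor zeroVec twist_bxor_right)
open Literature.Computability.QuantumComplexity.DerivativeWalsh (W sum_W_sq)
open Literature.Computability.QuantumComplexity.Simon (twist_eq_one_or)
open Summit.QuantumAdvantage.QuantumAdvantage.Theorems.SignedCubicForrelationNotPrBPP (knf_isDegLeFun_ip)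

variable {n : ℕ}

/-! ### Granularity and the quadratic tower -/

/-- **Walsh values of a quadratic function are granular**: `W_D(x) = 2^{⌈n/2⌉}·z` (Ax with `d = 2` applied to `D ⊕ ℓ_x`).
[cite: Carlet2020, §4.1] -/
theorem qs_W_granular (D : (Fin n → Bool) → Bool) (hD : IsDegLeFun 2 D) (x : Fin n → Bool) :
    ∃ z : ℤ, W (fun y => signOf (D y)) x = (2 : ℝ) ^ ((n + 1) / 2) * (z : ℝ) := by
  have hdeg : IsDegLeFun 2 (fun y : Fin n → Bool => D y ^^ decide (Odd (univ.filter fun i => y i && x i).card)) :=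
    bb_isDegLeFun_bxor hD ((knf_isDegLeFun_ip x).mono (by norm_num))
  obtain ⟨z, hz⟩ := stub_axParity n 2 _ univ (by norm_num) hdeg
  refine ⟨z, ?_⟩
  have he : (n + 2 - 1) / 2 = (n + 1) / 2 := by omega
  rw [filter_true_of_mem (fun u _ i _ => mem_univ i), card_fin, he] at hz
  rw [vg_W_eq_sum_signOf_bxor, hz]

/-- **The 2-adic Walsh tower for a QUADRATIC function** (`stub_walshTower` with Ax at `d = 2` on the complementary cube): if
`W_D = 2^j·u` then `x ↦ [u(x) odd]` has degree `≤ d` as soon as `j + 1 ≤ k + ⌈(n − k)/2⌉` for every `d < k ≤ n`.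
[cite: MacWilliamsSloane1977, Ch. 15 §2] -/
theorem qs_walshTower2 (n j d : ℕ) (D : (Fin n → Bool) → Bool) (u : (Fin n → Bool) → ℤ) (hD : IsDegLeFun 2 D)
    (hu : ∀ x, W (fun y => signOf (D y)) x = (2 : ℝ) ^ j * (u x : ℝ))
    (hside : ∀ k, d < k → k ≤ n → j + 1 ≤ k + (n - k + 1) / 2) :
    IsDegLeFun d (fun x => decide (Odd (u x))) := by
  refine bb_moebius_isDegLeFun d (fun x => decide (Odd (u x))) fun I hI => ?_
  have hP := bb_poisson (fun y => signOf (D y)) I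
  obtain ⟨z, hz⟩ := stub_axParity n 2 D Iᶜ (by norm_num) hD
  generalize hc : (Iᶜ.card + 2 - 1) / 2 = c at hz
  rw [sum_congr rfl fun x _ => hu x, ← mul_sum, hz] at hP
  have hk : #I ≤ n := (card_le_univ I).trans_eq (Fintype.card_fin n)
  have hj : #Iᶜ = n - #I := by rw [card_compl, Fintype.card_fin]
  have hjc : j + 1 ≤ #I + c := by
    have h := hside #I hI hk
    omega
  have hZ : (2 : ℤ) ^ j * ∑ x ∈ {x : Fin n → Bool | ∀ i, x i = true → i ∈ I}, u x = 2 ^ #I * (2 ^ c * z) := by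
    have h' : (((2 : ℤ) ^ j * ∑ x ∈ {x : Fin n → Bool | ∀ i, x i = true → i ∈ I}, u x : ℤ) : ℝ) =
        (((2 : ℤ) ^ #I * (2 ^ c * z) : ℤ) : ℝ) := by
      push_cast
      exact hP
    exact_mod_cast h'
  have hE := (tw_even_sum_iff _ u).1 (tw_even_of_balance hjc hZ)
  rw [filter_filter] at hE
  simpa only [decide_eq_true_eq] using hE

/-! ### One level of the tower on 12 bits: `u ∈ {0, ±1}` -/

/-- Parseval at level `j`: `W_D = 2^j·u` on 12 bits gives `4^j·Σ u² = 2^24`. [folklore] -/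
theorem qs_parseval (D : (Fin (6 + 6) → Bool) → Bool) (j : ℕ) (u : (Fin (6 + 6) → Bool) → ℤ)
    (hu : ∀ y, W (fun x => signOf (D x)) y = (2 : ℝ) ^ j * (u y : ℝ)) :
    (2 : ℤ) ^ (2 * j) * ∑ y, u y ^ 2 = 2 ^ 24 := by
  have h := sum_W_sq (fun x => signOf (D x))
  have hs1 : ∀ b : Bool, signOf b ^ 2 = (1 : ℝ) := by intro b; cases b <;> simp [signOf]
  rw [sum_congr rfl fun y _ => by rw [hu y], sum_congr rfl fun x _ => hs1 (D x), sum_const, card_univ,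
    Fintype.card_fun, Fintype.card_bool, Fintype.card_fin] at h
  have h1 : ∑ y, ((2 : ℝ) ^ j * (u y : ℝ)) ^ 2 = 16777216 := by rw [h]; norm_num
  have h' : (((2 : ℤ) ^ (2 * j) * ∑ y, u y ^ 2 : ℤ) : ℝ) = ((2 : ℤ) ^ 24 : ℤ) := by
    push_cast
    rw [← h1, mul_sum]
    exact sum_congr rfl fun y _ => by rw [mul_pow, ← pow_mul, mul_comm 2 j]
  exact_mod_cast h'

/-- **One level of the quadratic tower on 12 bits.**  If `W_D = 2^j·u` with `6 ≤ j ≤ 12` and some `u(y)` odd, then `u(y) = ±1` where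
`u` is odd and `u(y) = 0` elsewhere, and the odd set has `≥ 2^{24−2j}` points: degree `≤ 2j − 12` (tower) + Reed–Muller + Parseval.
[cite: MacWilliamsSloane1977, Ch. 15 §2] -/
theorem qs_level (D : (Fin (6 + 6) → Bool) → Bool) (hD : IsDegLeFun 2 D) (j : ℕ) (hj6 : 6 ≤ j) (hj12 : j ≤ 12)
    (u : (Fin (6 + 6) → Bool) → ℤ) (hu : ∀ y, W (fun x => signOf (D x)) y = (2 : ℝ) ^ j * (u y : ℝ))
    (hodd : ∃ y, Odd (u y)) :
    (∀ y, Odd (u y) → u y = 1 ∨ u y = -1) ∧ (∀ y, ¬ Odd (u y) → u y = 0) ∧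
      2 ^ 12 ≤ 2 ^ (2 * j - 12) * #(univ.filter fun y : Fin (6 + 6) → Bool => Odd (u y)) := by
  classical
  have hdeg : IsDegLeFun (2 * j - 12) (fun y => decide (Odd (u y))) :=
    qs_walshTower2 (6 + 6) j (2 * j - 12) D u hD hu (by intro k hk hkn; omega)
  have hRM := bb_rmWeight_holds (6 + 6) (2 * j - 12) (fun y => decide (Odd (u y))) hdeg
    (by obtain ⟨y, hy⟩ := hodd; exact ⟨y, decide_eq_true hy⟩)
  have hfilt : (univ.filter fun y : Fin (6 + 6) → Bool => decide (Odd (u y)) = true) = univ.filter fun y => Odd (u y) :=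
    filter_congr fun y _ => by simp
  rw [hfilt] at hRM
  set O := univ.filter (fun y : Fin (6 + 6) → Bool => Odd (u y)) with hO
  have hPars := qs_parseval D j u hu
  -- `#O ≤ Σ u²` termwise, `2^{2j}·#O ≥ 2^24 = 2^{2j}·Σ u²`
  have hterm : ∀ y, (if Odd (u y) then (1 : ℤ) else 0) ≤ u y ^ 2 := by
    intro y
    split_ifs with h
    · have h0 := Int.odd_iff.1 h
      have : u y ≤ -1 ∨ 1 ≤ u y := by omega
      have := tp_sq_ge (k := 1) (by norm_num) this
      linarith
    · exact sq_nonneg _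
  have hOsum : (#O : ℤ) = ∑ y, (if Odd (u y) then (1 : ℤ) else 0) := by
    rw [← sum_boole]
  have hge : (2 : ℤ) ^ 24 ≤ 2 ^ (2 * j) * #O := by
    have e : (2 : ℕ) ^ (2 * j) = 2 ^ 12 * 2 ^ (2 * j - 12) := by rw [← pow_add]; congr 1; omega
    have h1 : 2 ^ 12 * 2 ^ 12 ≤ 2 ^ (2 * j) * #O := by rw [e, mul_assoc]; exact Nat.mul_le_mul_left _ hRM
    have h2 : ((2 ^ 24 : ℕ) : ℤ) ≤ ((2 ^ (2 * j) * #O : ℕ) : ℤ) := by exact_mod_cast h1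
    push_cast at h2
    exact h2
  have hzero : ∑ y, (u y ^ 2 - (if Odd (u y) then (1 : ℤ) else 0)) = 0 := by
    have hnn : (0 : ℤ) ≤ ∑ y, (u y ^ 2 - (if Odd (u y) then (1 : ℤ) else 0)) := sum_nonneg fun y _ => by linarith [hterm y]
    have hle : (2 : ℤ) ^ (2 * j) * ∑ y, (u y ^ 2 - (if Odd (u y) then (1 : ℤ) else 0)) ≤ 0 := by
      rw [sum_sub_distrib, ← hOsum, mul_sub]; linarith
    have hpos : (0 : ℤ) < 2 ^ (2 * j) := by positivity
    nlinarith
  have hpt : ∀ y, u y ^ 2 = (if Odd (u y) then (1 : ℤ) else 0) := by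
    intro y
    have := (sum_eq_zero_iff_of_nonneg fun y _ => by linarith [hterm y]).1 hzero y (mem_univ _)
    linarith
  refine ⟨fun y hy => ?_, fun y hy => ?_, hRM⟩
  · have h := hpt y; rw [if_pos hy] at h
    have : (u y - 1) * (u y + 1) = 0 := by nlinarith
    rcases mul_eq_zero.1 this with h' | h'
    · left; linarith
    · right; linarith
  · have h := hpt y; rw [if_neg hy] at h
    exact pow_eq_zero_iff (n := 2) (by norm_num) |>.1 h

/-- **Climbing the tower** from the granularity level `6`: at the first level `6 + i ≤ 12` with an odd value, `qs_level` applies.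
[cite: MacWilliamsSloane1977, Ch. 15 §2] -/
theorem qs_climb (D : (Fin (6 + 6) → Bool) → Bool) (hD : IsDegLeFun 2 D) :
    ∀ m i : ℕ, i + m = 6 → ∀ u : (Fin (6 + 6) → Bool) → ℤ, (∀ y, W (fun x => signOf (D x)) y = (2 : ℝ) ^ (6 + i) * (u y : ℝ)) →
      ∃ j, 6 ≤ j ∧ j ≤ 12 ∧ ∃ v : (Fin (6 + 6) → Bool) → ℤ, (∀ y, W (fun x => signOf (D x)) y = (2 : ℝ) ^ j * (v y : ℝ)) ∧
        (∀ y, v y = 0 ∨ v y = 1 ∨ v y = -1) ∧ 2 ^ 12 ≤ 2 ^ (2 * j - 12) * #(univ.filter fun y : Fin (6 + 6) → Bool => v y ≠ 0) := by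
  classical
  have pack : ∀ (j : ℕ) (u : (Fin (6 + 6) → Bool) → ℤ), 6 ≤ j → j ≤ 12 →
      (∀ y, W (fun x => signOf (D x)) y = (2 : ℝ) ^ j * (u y : ℝ)) → (∃ y, Odd (u y)) →
      ∃ j, 6 ≤ j ∧ j ≤ 12 ∧ ∃ v : (Fin (6 + 6) → Bool) → ℤ, (∀ y, W (fun x => signOf (D x)) y = (2 : ℝ) ^ j * (v y : ℝ)) ∧
        (∀ y, v y = 0 ∨ v y = 1 ∨ v y = -1) ∧ 2 ^ 12 ≤ 2 ^ (2 * j - 12) * #(univ.filter fun y : Fin (6 + 6) → Bool => v y ≠ 0) := by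
    intro j u hj6 hj12 hu hodd
    obtain ⟨h1, h0, hRM⟩ := qs_level D hD j hj6 hj12 u hu hodd
    refine ⟨j, hj6, hj12, u, hu, fun y => ?_, ?_⟩
    · by_cases hy : Odd (u y)
      · exact Or.inr (h1 y hy)
      · exact Or.inl (h0 y hy)
    · have e : (univ.filter fun y : Fin (6 + 6) → Bool => u y ≠ 0) = univ.filter fun y => Odd (u y) := by
        refine filter_congr fun y _ => ⟨fun h => ?_, fun h h0' => ?_⟩
        · by_contra hne; exact h (h0 y hne)
        · rw [h0'] at h; exact absurd h (by decide)
      rw [e]; exact hRM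
  intro m
  induction m with
  | zero =>
    intro i him u hu
    have hi : i = 6 := by omega
    subst hi
    refine pack 12 u (by norm_num) le_rfl (fun y => (hu y).trans (by norm_num)) ?_
    by_contra hne
    push Not at hne
    have hP := qs_parseval D 12 u (fun y => (hu y).trans (by norm_num))
    have h4 : ∀ y, (4 : ℤ) ∣ u y ^ 2 := fun y => by
      obtain ⟨k, hk⟩ := Int.not_odd_iff_even.1 (hne y)
      exact ⟨k ^ 2, by rw [hk]; ring⟩
    have hdvd : (4 : ℤ) ∣ ∑ y, u y ^ 2 := dvd_sum fun y _ => h4 y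
    have hone : ∑ y, u y ^ 2 = 1 := by
      have : (2 : ℤ) ^ (2 * 12) = 2 ^ 24 := by norm_num
      rw [this] at hP
      linarith
    rw [hone] at hdvd
    omega
  | succ m ih =>
    intro i him u hu
    by_cases hodd : ∃ y, Odd (u y)
    · exact pack (6 + i) u (by omega) (by omega) hu hodd
    · push Not at hodd
      have hup := tw_level_up (j := 6 + i) D u hu hodd
      exact ih (i + 1) (by omega) (fun y => u y / 2) (fun y => (hup y).trans (by rw [show 6 + i + 1 = 6 + (i + 1) by ring]))

/-- **The Walsh spectrum of a quadratic function on 12 bits**: `W_D ∈ {0, ±2^j}` for one `j ∈ [6, 12]`, the support having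
`≥ 2^{24−2j}` points (so `W_D = ±64` everywhere when `j = 6`).  [cite: MacWilliamsSloane1977, Ch. 15 §2] -/
theorem qs_spectrum (D : (Fin (6 + 6) → Bool) → Bool) (hD : IsDegLeFun 2 D) :
    ∃ j, 6 ≤ j ∧ j ≤ 12 ∧ ∃ v : (Fin (6 + 6) → Bool) → ℤ, (∀ y, W (fun x => signOf (D x)) y = (2 : ℝ) ^ j * (v y : ℝ)) ∧
      (∀ y, v y = 0 ∨ v y = 1 ∨ v y = -1) ∧ 2 ^ 12 ≤ 2 ^ (2 * j - 12) * #(univ.filter fun y : Fin (6 + 6) → Bool => v y ≠ 0) := by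
  choose u hu using fun y => qs_W_granular D hD y
  exact qs_climb D hD 6 0 rfl u (fun y => (hu y).trans (by norm_num))

/-! ### Half-space transforms -/

/-- **Transform of a function cut to a half-space**: `Σ_{x : (−1)^{γ·x} = t} F(x)(−1)^{x·y} = (F̂(y) + t·F̂(γ ⊕ y))/2` (`t = ±1`).
[cite: ODonnell2014, §3.3] -/
theorem qs_halfspace (F : (Fin n → Bool) → ℝ) (γ : Fin n → Bool) (t : ℝ) (ht : t = 1 ∨ t = -1) (y : Fin n → Bool) :
    ∑ x ∈ univ.filter (fun x => twist γ x = t), F x * twist x y = (W F y + t * W F (bxor γ y)) / 2 := by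
  unfold W
  rw [sum_filter, mul_sum, ← sum_add_distrib, Finset.sum_div]
  refine sum_congr rfl fun x _ => ?_
  rw [twist_bxor_right, twist_comm x γ]
  rcases twist_eq_one_or γ x with h | h <;> rcases ht with ht | ht <;> rw [h, ht] <;> norm_num

/-- **A quadratic sign pattern on a half-space has transform in `64ℤ`, and either all quotients are even or all are `≤ 2` in size.**
For quadratic `D` on 12 bits and `P = {x : (−1)^{γ·x} = t}`: `Σ_{x∈P} (−1)^{D(x)} (−1)^{x·y} = 64·m(y)` with
`(∀ y, m(y) even) ∨ (∀ y, |m(y)| ≤ 2)` (levels `j ≥ 8`, resp. `j ∈ {6, 7}`, of `qs_spectrum`).  NOT summit progress. [this work] -/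
theorem qs_hyperplane_sum (D : (Fin (6 + 6) → Bool) → Bool) (hD : IsDegLeFun 2 D) (γ : Fin (6 + 6) → Bool) (t : ℝ)
    (ht : t = 1 ∨ t = -1) :
    ∃ m : (Fin (6 + 6) → Bool) → ℤ,
      (∀ y, ∑ x ∈ univ.filter (fun x : Fin (6 + 6) → Bool => twist γ x = t), (sZ (D x) : ℝ) * twist x y = 64 * (m y : ℝ)) ∧
      ((∀ y, Even (m y)) ∨ (∀ y, |m y| ≤ 2)) := by
  classical
  obtain ⟨tZ, htZ, htZ'⟩ : ∃ tZ : ℤ, (tZ : ℝ) = t ∧ (tZ = 1 ∨ tZ = -1) := by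
    rcases ht with rfl | rfl
    · exact ⟨1, by norm_num, Or.inl rfl⟩
    · exact ⟨-1, by norm_num, Or.inr rfl⟩
  obtain ⟨j, hj6, hj12, v, hv, hval, hsupp⟩ := qs_spectrum D hD
  have hS : ∀ y, ∑ x ∈ univ.filter (fun x : Fin (6 + 6) → Bool => twist γ x = t), (sZ (D x) : ℝ) * twist x y =
      2 ^ j * ((v y : ℝ) + tZ * v (bxor γ y)) / 2 := by
    intro y
    have h := qs_halfspace (fun x => ((sZ (D x) : ℤ) : ℝ)) γ t ht y
    have e : (fun x : Fin (6 + 6) → Bool => ((sZ (D x) : ℤ) : ℝ)) = fun x => signOf (D x) := funext fun x => tp_sZ_cast _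
    rw [e, hv, hv] at h
    rw [h, ← htZ]; ring
  by_cases hj8 : 8 ≤ j
  · refine ⟨fun y => 2 ^ (j - 7) * (v y + tZ * v (bxor γ y)), fun y => ?_, Or.inl fun y => ?_⟩
    · show _ = 64 * (((2 ^ (j - 7) * (v y + tZ * v (bxor γ y)) : ℤ)) : ℝ)
      rw [hS y]
      obtain ⟨i, hi⟩ : ∃ i, j = i + 8 := ⟨j - 8, by omega⟩
      subst hi
      rw [show i + 8 - 7 = i + 1 by omega]
      push_cast
      ring
    · show Even (2 ^ (j - 7) * (v y + tZ * v (bxor γ y)))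
      obtain ⟨i, hi⟩ : ∃ i, j - 7 = i + 1 := ⟨j - 8, by omega⟩
      rw [hi, pow_succ]
      exact ⟨2 ^ i * (v y + tZ * v (bxor γ y)), by ring⟩
  · by_cases hj7 : j = 7
    · subst hj7
      refine ⟨fun y => v y + tZ * v (bxor γ y), fun y => ?_, Or.inr fun y => ?_⟩
      · show _ = 64 * (((v y + tZ * v (bxor γ y) : ℤ)) : ℝ)
        rw [hS y]; push_cast; ring
      · show |v y + tZ * v (bxor γ y)| ≤ 2
        rw [abs_le]
        rcases hval y with h | h | h <;> rcases hval (bxor γ y) with h' | h' | h' <;> rcases htZ' with h'' | h'' <;>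
          rw [h, h', h''] <;> norm_num
    · have hj : j = 6 := by omega
      subst hj
      -- `v = ±1` everywhere
      have hne : ∀ y, v y ≠ 0 := by
        intro y
        have hcard : #(univ.filter fun y : Fin (6 + 6) → Bool => v y ≠ 0) = #(univ : Finset (Fin (6 + 6) → Bool)) := by
          apply le_antisymm (card_le_univ _)
          simp only [Fintype.card_fun, Fintype.card_bool, Fintype.card_fin]
          norm_num at hsupp ⊢
          exact hsupp
        have hmem : y ∈ univ.filter fun y : Fin (6 + 6) → Bool => v y ≠ 0 := by
          rw [eq_univ_of_card _ hcard]; exact mem_univ _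
        exact (mem_filter.1 hmem).2
      have hpm : ∀ y, v y = 1 ∨ v y = -1 := fun y => (hval y).resolve_left (hne y)
      have hex : ∀ y, ∃ m : ℤ, v y + tZ * v (bxor γ y) = 2 * m ∧ |m| ≤ 2 := by
        intro y
        refine ⟨(v y + tZ * v (bxor γ y)) / 2, ?_, ?_⟩ <;>
          rcases hpm y with h | h <;> rcases hpm (bxor γ y) with h' | h' <;> rcases htZ' with h'' | h'' <;> rw [h, h', h''] <;> norm_num
      choose m hm hm2 using hex
      refine ⟨m, fun y => ?_, Or.inr hm2⟩
      rw [hS y]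
      have h := hm y
      have h' : ((v y : ℝ) + tZ * v (bxor γ y)) = 2 * (m y : ℝ) := by exact_mod_cast h
      rw [h']; ring

end Summit.QuantumAdvantage.QuantumAdvantage.Theorems.CubicForrelation.NearExactIsExact

end
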